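import Summits.Ventures.PercRepro.C025ProfileThinNonSimple

/-!
# THE ROW `(q, q+1)` OF (Π) WITHOUT SIMPLICITY — part A: the sums, the loop doubling, the rooted price (night-3 g17)
`C025ProfileThinNonSimple` dropped the simplicity hypothesis of g16's thin theorem at the level of C-025 (Theorem F).  Parts A / B do the
same for the PROFILE ROW `(q, q+1)` itself (`Profile.ProfileIneq M q (q + 1)`, the statement of C-032).  This part:
* the row as sums over the powerset of the ground set with the rank condition inside (`sum_Rq_eq_sum_powerset`,
  `card_levelSet_eq_sum`), the four-way split of a powerset sum by two points (`sum_powerset_insert_insert`), the ground sets of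
  `M ＼ {e}` / `M ／ {e}` (`gr_delete`, `gr_contract`) and the price as a function of the complement rank alone (`price_eq_of_eRk_eq`);
* **a loop doubles the row**: `profileIneq_of_isLoop` — for a loop `ℓ`, every term of the row of `M` is a term of the row of `M ＼ {ℓ}`
  taken twice (`B ↦ B ∖ {ℓ}`: ranks and complement ranks unchanged), on both sides;
* **the rooted price**: `rooted_price_le` / `price_rooted_le` — a rank-`(q+1)` set whose complement has rank `p + 1` pays, at level
  `q + 2`, `C(p+q+2, q+2)/C(p+q+2, q+1) = (p+1)/(q+2) ≤ p/(q+1) = C(p+q, q+1)/C(p+q, q)`, the price of a rank-`q` set with complement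
  rank `p` at level `q + 1`, exactly when `q + 1 ≤ p` — which is also the common threshold.  This is what makes the parallel-pair step
  of part B a clean reduction to the contraction.
No `def`, no `instance`, no notation.  Axioms: standard.
-/
open scoped Matroid
namespace PercRepro
open Set Finset ThmH Staged
namespace ThinGirth
variable {α : Type} [DecidableEq α] {M : Matroid α} [M.Finite]

/-! ### Sums over `Rq` and the level sets as sums over the powerset of the ground set -/

omit [DecidableEq α] in
/-- A sum over the rank-`q` sets is a sum over the powerset of the ground set with the rank condition inside. -/
theorem sum_Rq_eq_sum_powerset (q : ℕ) (f : Finset α → ℚ) :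
    ∑ B ∈ Profile.Rq M q, f B =
      ∑ B ∈ (gr M).powerset, if M.eRk (B : Set α) = (q : ℕ∞) then f B else 0 := by
  classical
  unfold Profile.Rq
  rw [Finset.sum_filter]

omit [DecidableEq α] in
/-- The size of a level set as a sum of indicators over the powerset of the ground set. -/
theorem card_levelSet_eq_sum (u : ℕ) :
    ((Shadow.levelSet M u).card : ℚ) =
      ∑ S ∈ (gr M).powerset, if M.eRk (S : Set α) = (u : ℕ∞) then (1 : ℚ) else 0 := by
  classical
  unfold Shadow.levelSet
  rw [Finset.card_filter]
  push_cast
  rfl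

/-- Sums over the powerset of `insert y (insert x G)`, `x ≠ y` outside `G`, split into four sums over the powerset of `G`. -/
theorem sum_powerset_insert_insert {G : Finset α} {x y : α} (hxy : x ≠ y) (hx : x ∉ G) (hy : y ∉ G)
    (f : Finset α → ℚ) :
    ∑ B ∈ (insert y (insert x G)).powerset, f B =
      ∑ T ∈ G.powerset, (f T + f (insert x T) + f (insert y T) + f (insert y (insert x T))) := by
  have hy' : y ∉ insert x G := by
    rw [Finset.mem_insert]
    rintro (h | h)
    · exact hxy h.symm
    · exact hy h
  rw [Finset.sum_powerset_insert hy', Finset.sum_powerset_insert hx, Finset.sum_powerset_insert hx]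
  rw [← Finset.sum_add_distrib, ← Finset.sum_add_distrib, ← Finset.sum_add_distrib]
  apply Finset.sum_congr rfl
  intro T _
  ring

/-- The ground set of `M ＼ {e}` is `gr M` minus `e`. -/
theorem gr_delete (e : α) : gr (M ＼ {e}) = (gr M).erase e := by
  apply Finset.coe_injective
  rw [coe_gr, Finset.coe_erase, coe_gr, Matroid.delete_ground]

/-- The ground set of `M ／ {e}` is `gr M` minus `e`. -/
theorem gr_contract (e : α) : gr (M ／ {e}) = (gr M).erase e := by
  apply Finset.coe_injective
  rw [coe_gr, Finset.coe_erase, coe_gr, Matroid.contract_ground]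

/-- The price depends on `M` and `B` only through the rank of the complement. -/
theorem price_eq_of_eRk_eq {M' : Matroid α} [M'.Finite] {q u : ℕ} {B B' : Finset α}
    (h : M.eRk ((gr M \ B : Finset α) : Set α) = M'.eRk ((gr M' \ B' : Finset α) : Set α)) :
    Profile.price M q u B = Profile.price M' q u B' := by
  unfold Profile.price
  rw [h]

/-! ### A loop doubles the row -/

/-- **A loop doubles both sides of the row**: for a loop `ℓ`, `ProfileIneq (M ＼ {ℓ}) q u` gives `ProfileIneq M q u`
(every term of `M` is a term of `M ＼ {ℓ}` counted twice, `B ↦ B ∖ {ℓ}`). -/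
theorem profileIneq_of_isLoop {ℓ : α} (hℓ : M.IsLoop ℓ) {q u : ℕ}
    (h : Profile.ProfileIneq (M ＼ {ℓ}) q u) : Profile.ProfileIneq M q u := by
  have hℓE : ℓ ∈ M.E := hℓ.mem_ground
  have hℓg : ℓ ∈ gr M := mem_gr_of_mem_ground hℓE
  have hG : gr M = insert ℓ (gr (M ＼ {ℓ})) := by
    rw [gr_delete, Finset.insert_erase hℓg]
  have hℓG' : ℓ ∉ gr (M ＼ {ℓ}) := by
    rw [gr_delete]
    exact Finset.notMem_erase ℓ _
  -- ranks of sets avoiding `ℓ`, with or without `ℓ` added, in `M` and in `M ＼ {ℓ}`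
  have hrk : ∀ T ⊆ gr (M ＼ {ℓ}), M.eRk (T : Set α) = (M ＼ {ℓ}).eRk (T : Set α) := by
    intro T hT
    rw [delete_singleton_eRk_eq]
    rw [← Matroid.delete_ground, ← coe_gr]
    exact_mod_cast hT
  have hrk' : ∀ T ⊆ gr (M ＼ {ℓ}), M.eRk ((insert ℓ T : Finset α) : Set α) = (M ＼ {ℓ}).eRk (T : Set α) := by
    intro T hT
    have hTE : (T : Set α) ⊆ M.E := by
      have : (T : Set α) ⊆ (M ＼ {ℓ}).E := by rw [← coe_gr]; exact_mod_cast hT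
      rw [Matroid.delete_ground] at this
      exact this.trans Set.sdiff_subset
    rw [Finset.coe_insert, eRk_insert_eq_of_mem_closure hTE (hℓ.mem_closure _), hrk T hT]
  -- complements
  have hc1 : ∀ T ⊆ gr (M ＼ {ℓ}), gr M \ T = insert ℓ (gr (M ＼ {ℓ}) \ T) := by
    intro T hT
    rw [hG, Finset.insert_sdiff_of_notMem _ (fun hx => hℓG' (hT hx))]
  have hc2 : ∀ T ⊆ gr (M ＼ {ℓ}), gr M \ insert ℓ T = gr (M ＼ {ℓ}) \ T := by
    intro T _
    rw [hG, Finset.insert_sdiff_insert, Finset.sdiff_insert,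
      Finset.erase_eq_of_notMem (fun h => hℓG' (Finset.mem_sdiff.1 h).1)]
  unfold Profile.ProfileIneq at h ⊢
  rw [sum_Rq_eq_sum_powerset, card_levelSet_eq_sum] at h ⊢
  rw [hG, Finset.sum_powerset_insert hℓG', Finset.sum_powerset_insert hℓG']
  -- the four sums, termwise
  have e1 : ∀ T ∈ (gr (M ＼ {ℓ})).powerset,
      (if M.eRk (T : Set α) = (q : ℕ∞) then Profile.price M q u T else 0) =
        (if (M ＼ {ℓ}).eRk (T : Set α) = (q : ℕ∞) then Profile.price (M ＼ {ℓ}) q u T else 0) := by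
    intro T hT
    rw [Finset.mem_powerset] at hT
    rw [hrk T hT]
    congr 1
    apply price_eq_of_eRk_eq
    rw [hc1 T hT, hrk' _ (Finset.sdiff_subset)]
  have e2 : ∀ T ∈ (gr (M ＼ {ℓ})).powerset,
      (if M.eRk ((insert ℓ T : Finset α) : Set α) = (q : ℕ∞) then Profile.price M q u (insert ℓ T) else 0) =
        (if (M ＼ {ℓ}).eRk (T : Set α) = (q : ℕ∞) then Profile.price (M ＼ {ℓ}) q u T else 0) := by
    intro T hT
    rw [Finset.mem_powerset] at hT
    rw [hrk' T hT]
    congr 1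
    apply price_eq_of_eRk_eq
    rw [hc2 T hT, hrk _ (Finset.sdiff_subset)]
  have e3 : ∀ T ∈ (gr (M ＼ {ℓ})).powerset,
      (if M.eRk (T : Set α) = (u : ℕ∞) then (1 : ℚ) else 0) =
        (if (M ＼ {ℓ}).eRk (T : Set α) = (u : ℕ∞) then (1 : ℚ) else 0) := by
    intro T hT
    rw [Finset.mem_powerset] at hT
    rw [hrk T hT]
  have e4 : ∀ T ∈ (gr (M ＼ {ℓ})).powerset,
      (if M.eRk ((insert ℓ T : Finset α) : Set α) = (u : ℕ∞) then (1 : ℚ) else 0) =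
        (if (M ＼ {ℓ}).eRk (T : Set α) = (u : ℕ∞) then (1 : ℚ) else 0) := by
    intro T hT
    rw [Finset.mem_powerset] at hT
    rw [hrk' T hT]
  rw [Finset.sum_congr rfl e1, Finset.sum_congr rfl e2, Finset.sum_congr rfl e3, Finset.sum_congr rfl e4]
  linarith

/-! ### A parallel pair is a profile Theorem F -/

omit [DecidableEq α] [M.Finite] in
/-- `ite` with equivalent conditions and equal values. -/
theorem ite_congr_of_iff {c d : Prop} [Decidable c] [Decidable d] (h : c ↔ d) {a b : ℚ} (hab : c → a = b) :
    (if c then a else 0) = (if d then b else 0) := by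
  by_cases hc : c
  · rw [if_pos hc, if_pos (h.1 hc), hab hc]
  · rw [if_neg hc, if_neg (fun hd => hc (h.2 hd))]

omit [DecidableEq α] [M.Finite] in
/-- `ite` with equivalent conditions and comparable values. -/
theorem ite_le_of_iff {c d : Prop} [Decidable c] [Decidable d] (h : c ↔ d) {a b : ℚ} (hab : c → a ≤ b) :
    (if c then a else 0) ≤ (if d then b else 0) := by
  by_cases hc : c
  · rw [if_pos hc, if_pos (h.1 hc)]; exact hab hc
  · rw [if_neg hc, if_neg (fun hd => hc (h.2 hd))]

omit [DecidableEq α] in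
/-- `ρ(T) + 1 = q + 1 ⟺ ρ(T) = q` for a finite set. -/
theorem eRk_add_one_eq_iff (T : Finset α) (q : ℕ) :
    M.eRk (T : Set α) + 1 = ((q + 1 : ℕ) : ℕ∞) ↔ M.eRk (T : Set α) = (q : ℕ∞) := by
  rw [← coe_rkN, ← Nat.cast_succ, Nat.cast_inj, Nat.cast_inj]
  omega

omit [DecidableEq α] [M.Finite] in
/-- `C(n, k+1) / C(n, k) = (n − k) / (k + 1)` in `ℚ`, `k ≤ n`. -/
theorem choose_succ_div_choose (n k : ℕ) (hk : k ≤ n) :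
    (n.choose (k + 1) : ℚ) / (n.choose k : ℚ) = ((n - k : ℕ) : ℚ) / ((k + 1 : ℕ) : ℚ) := by
  have h := Nat.choose_succ_right_eq n k
  have hpos : (0 : ℚ) < n.choose k := by exact_mod_cast Nat.choose_pos hk
  rw [div_eq_div_iff hpos.ne' (by positivity)]
  exact_mod_cast (by rw [h, mul_comm] : n.choose (k + 1) * (k + 1) = (n - k) * n.choose k)

omit [DecidableEq α] [M.Finite] in
/-- **The rooted price is at most the price of the contraction**: `C(p+q+2, q+2)/C(p+q+2, q+1) = (p+1)/(q+2) ≤ p/(q+1) =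
C(p+q, q+1)/C(p+q, q)` when `q + 1 ≤ p`. -/
theorem rooted_price_le (p q : ℕ) (hp : q + 1 ≤ p) :
    (Nat.choose (p + 1 + (q + 1)) (q + 1 + 1) : ℚ) / (Nat.choose (p + 1 + (q + 1)) (q + 1) : ℚ) ≤
      (Nat.choose (p + q) (q + 1) : ℚ) / (Nat.choose (p + q) q : ℚ) := by
  rw [choose_succ_div_choose (p + 1 + (q + 1)) (q + 1) (by omega), choose_succ_div_choose (p + q) q (by omega)]
  have e1 : p + 1 + (q + 1) - (q + 1) = p + 1 := by omega
  have e2 : p + q - q = p := by omega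
  rw [e1, e2, div_le_iff₀ (by positivity), div_mul_eq_mul_div, le_div_iff₀ (by positivity)]
  have hp' : (q : ℚ) + 1 ≤ p := by exact_mod_cast hp
  push_cast
  nlinarith [hp']

/-- The rooted price (complement rank `p + 1` in `M`) at `(q+1, q+2)` is at most the price at `(q, q+1)` of a set with complement
rank `p` in `N`. -/
theorem price_rooted_le {N : Matroid α} [N.Finite] (q : ℕ) {B B' : Finset α}
    (h : M.eRk ((gr M \ B : Finset α) : Set α) = N.eRk ((gr N \ B' : Finset α) : Set α) + 1) :
    Profile.price M (q + 1) (q + 1 + 1) B ≤ Profile.price N q (q + 1) B' := by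
  unfold Profile.price
  rw [h, ← coe_rkN, ← Nat.cast_succ, ENat.toNat_coe, ENat.toNat_coe]
  by_cases hqp : q + 1 ≤ rkN N (gr N \ B')
  · rw [if_pos (by exact_mod_cast (by omega : q + 1 + 1 ≤ rkN N (gr N \ B') + 1)), if_pos (by exact_mod_cast hqp)]
    exact rooted_price_le _ q hqp
  · rw [if_neg (by
      intro hc
      apply hqp
      have : q + 1 + 1 ≤ rkN N (gr N \ B') + 1 := by exact_mod_cast hc
      omega)]
    rw [if_neg (by intro hc; apply hqp; exact_mod_cast hc)]

omit [DecidableEq α] [M.Finite] in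
/-- A subset of the ground set avoiding `e`, as a set, is a subset of `M.E ∖ {e}`. -/
theorem coe_subset_diff_singleton {T : Finset α} (hT : (T : Set α) ⊆ M.E) {e : α} (he : e ∉ T) :
    (T : Set α) ⊆ M.E \ {e} :=
  fun _ hz => ⟨hT hz, fun h => he (mem_singleton_iff.1 h ▸ Finset.mem_coe.1 hz)⟩

end ThinGirth
end PercRepro
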